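import Summits.Ventures.PercRepro.MSTightTwinFreeProduct
import Summits.Ventures.PercRepro.MSTightDichotomy

/-!
# Excess-one families with a tight one-point extension: their differences form a down-set

Dossier proofs/MINE1-theoremS.md, Addendum 48 §4 (a). Let `F` be a family of finite sets of
Marica–Schönheim excess one, `|F \\ F| = |F| + 1`, and suppose some set `u ∉ F` makes `F ∪ {u}`
tight. Then `F ∪ {u}` has `|F| + 1` members and `|F| + 1` differences, and the differences of `F`
are among them; so `F \\ F = (F ∪ {u}) \\ (F ∪ {u})` (`diffs_insert_eq_of_tight_insert`). When `F`
is twin-free, so is `F ∪ {u}`, and Theorem S (`isDownSet_diffs_of_twinFree`) makes the difference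
family of the tight family `F ∪ {u}` — hence that of `F` — a down-set
(`isDownSet_diffs_of_tight_insert`). Consequently Conjecture (T) holds at EVERY element `r` for
such a family: `diffsY r F ⊆ diffsX r F` (`diffsY_subset_diffsX_of_tight_insert`, through
`diffsY_subset_diffsX`). Census (Addendum 48): no configuration of the open shape of Conjecture (T)
has a tight one-point extension, so this settles exactly the complement of the block case.
-/

namespace PercRepro.MSTight

open Finset
open scoped FinsetFamily

variable {α : Type*} [DecidableEq α] [Fintype α]

omit [Fintype α] in
/-- If `F` has Marica–Schönheim excess one and `insert u F` is tight for some `u ∉ F`, then the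
two families have the same differences. -/
theorem diffs_insert_eq_of_tight_insert {F : Finset (Finset α)} {u : Finset α}
    (hex : (F \\ F).card = F.card + 1) (hu : u ∉ F) (hT : Tight (insert u F)) :
    insert u F \\ insert u F = F \\ F := by
  have hsub : F \\ F ⊆ insert u F \\ insert u F :=
    diffs_subset (subset_insert _ _) (subset_insert _ _)
  have hcard : (insert u F).card = F.card + 1 := card_insert_of_notMem hu
  symm
  apply eq_of_subset_of_card_le hsub
  unfold Tight at hT
  omega

omit [Fintype α] in
/-- Twins of a family are twins of every subfamily; in particular twin-freeness of `F` passes to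
`insert u F`. -/
theorem twin_of_twin_insert {F : Finset (Finset α)} {u : Finset α} {a b : α}
    (h : Twin (insert u F) a b) : Twin F a b :=
  fun t ht => h t (mem_insert_of_mem ht)

/-- **(YD) for families with a tight one-point extension.** A twin-free family of
Marica–Schönheim excess one that has a tight one-point extension has a down-closed difference
family. -/
theorem isDownSet_diffs_of_tight_insert {F : Finset (Finset α)} {u : Finset α}
    (hex : (F \\ F).card = F.card + 1) (hu : u ∉ F) (hT : Tight (insert u F))
    (htf : ∀ a b, Twin F a b → a = b) : IsDownSet (F \\ F) := by
  rw [← diffs_insert_eq_of_tight_insert hex hu hT]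
  exact isDownSet_diffs_of_twinFree hT (fun a b h => htf a b (twin_of_twin_insert h))

/-- **Conjecture (T) at every direction** for a twin-free excess-one family with a tight one-point
extension: every `r`-difference with `r` removed is an `r`-free difference. -/
theorem diffsY_subset_diffsX_of_tight_insert {F : Finset (Finset α)} {u : Finset α}
    (hex : (F \\ F).card = F.card + 1) (hu : u ∉ F) (hT : Tight (insert u F))
    (htf : ∀ a b, Twin F a b → a = b) (r : α) : diffsY r F ⊆ diffsX r F :=
  diffsY_subset_diffsX (isDownSet_diffs_of_tight_insert hex hu hT htf)

end PercRepro.MSTight
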